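import Summits.QuantumFields.BalabanUV.Beta.HessKerCoDressedBmWall
import Summits.QuantumFields.BalabanUV.Beta.GAN24.CombesThomas

/-!
# HessKerConvCKPlug — `GAN24.CombesThomas.ConvCKWall 3 Lc` PLUGGED INTO THE FOUR K-SLOT WALL SOCKETS, WITH THE RATE ∕ WINDOW MERGE

[folklore] bookkeeping only (β-PERT ACCELERATION, asymptotic lane asym1; the consumer-side END of the swarm's (CONV-C) K-slot target).

The four entrywise-K-row sockets of the `j → ∞` wall —
`HessKerDressedUnitsWall.d1Drift_JsBalOf_iff_of_cauchy_unit` (the `JsBalOf` family, AXIALLY dressed limits; the socket road P1's assembly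
`GAN24/ConvCKHolds` (LEAVES row P1-L12) instantiates through `GAN24.CombesThomas.d1Drift_JsBalOf_iff_of_unitDecayK_supRateK_step`),
`HessKerRootedWall.d1Drift_JsBalAn1At_iff_of_cauchy_unit` (v2.22 = `JsBalAn1At`, identification at the ROOTED-dressed entrywise limits),
`HessKerCoDressedWall.d1Drift_JsBalAn1At_iff_codressed_of_unit_rows` (v2.22, ROOTED co-dressed limit, window `R < δK/4`) and
`HessKerCoDressedBmWall.d1Drift_JsBalBmAn1At_iff_codressedBm_of_unit_rows` (v2.23, BLOCK-MEAN co-dressed limit, window `R < δK/4`) —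
take ONE rate `θ` for the K-, S- and W-difference rows and ONE window `R`.  The swarm's packaged K-slot target
`GAN24.CombesThomas.ConvCKWall 3 Lc = ∃ C δ cK θ, 0 < δ ∧ 0 ≤ θ < 1 ∧ UnitDecayK … ∧ CauchyDecayK …` brings ITS OWN `(δ_K, θ_K)`, and the S-∕W-rows
(an2's, «after (P4)») will bring theirs.  This file does the two [folklore] lines once and for all (cross-read remark I1 of
gan24-formalise-leaf-02-g7 on `HessKerCoDressedBmWall`): weaken every difference row to the common rate `θ := max (θ_K, θ_S, θ_W) < 1`
(constants are ≥ 0 by the `k = 0` rows) and take the window `R := min (δ_K/8, δ_S, δ_W/2)`; then each socket fires.  RESULT (§2): for each of the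
three identifications, `ConvCKWall 3 Lc →` (S-rows at any rate `θ_S ∈ [0,1)`, decay `δ_S > 0`) `→` (W-rows at any `θ_W ∈ [0,1)`, `δ_W > 0`) `→`
(`D1Drift Lc 𝒯^{bal} N μ ν ↔` the explicit identification at the constructed limits), in the ADOPTED units `(sfStep Lc, smStep 3 Lc) = (Lc^j, Lc^{4j})`.

HONEST FRAMING.  Nothing is instantiated at a value and NOTHING is discharged: `ConvCKWall 3 Lc` is the swarm's OPEN proof target (G-an2-4 ∕
(CONV-C) K-slot, roads P1 ∕ P4 — asserted nowhere, a HYPOTHESIS here), the S-∕W-rows are an2's open rows, the identification itself is O-asym1-7,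
and v2.22 ∕ v2.23 are CANDIDATES pending β-LEAD's ruling (R42-1).  0 of `FlowStep.BetaPertH`.  Discharging BetaPertH would make Bałaban's
UV stability UNCONDITIONAL — NOT the continuum limit, NOT Clay.  HONEST DEPENDENCY: continuum YM on T⁴ ⇐ BetaPertH ∧ nine spine estimates
(0/9 proved); BetaPertH ⇐ (D1) ∧ (D4) ∧ CAP+tail; G-an2-4 gates asym, D1 and NE2/3/4.
-/

open Literature.MathematicalPhysics.QuantumFieldTheory.Balaban1983to89
open Literature.MathematicalPhysics.QuantumFieldTheory.Balaban1983to89.Beta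
open Literature.MathematicalPhysics.QuantumFieldTheory.Balaban1983to89.B12Sec2to5 (l1_nonneg)
open ExpKernelCalculus (MKer Decays BiLoc VertexFamily₂ hessKer)
open AffineAveraging (box toSite)
open OneStepResolventKernel (Fib LocStencil bound_mono decays_mono)
open OneStepKernelFamily (vertexOfK KInvStep D1Drift)
open HessKerDressedLimit (limMKerOf limStOf limTabOf)
open AxialDressing (axDressK axVertexOfK)
open BalabanStepJetsSucc (JsBal0Of JsBalOf)
open Summit.QuantumFields.BalabanUV.Beta.HessKerDressedUnits
open Summit.QuantumFields.BalabanUV.Beta.HessKerDressedUnitsWall (d1Drift_JsBalOf_iff_of_cauchy_unit)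
open Summit.QuantumFields.BalabanUV.Beta.AxialDressingRooted (dressKAt coProjAtK coDressKAt coDressKBmAt)
open Summit.QuantumFields.BalabanUV.Beta.SpineRooted (JsBal0AtOf JsBalAn1At JsBalBmAn1At WbalAtOf T2AtOf)
open Summit.QuantumFields.BalabanUV.Beta.HessKerRootedWall (d1Drift_JsBalAn1At_iff_of_cauchy_unit)
open Summit.QuantumFields.BalabanUV.Beta.HessKerCoDressedWall (d1Drift_JsBalAn1At_iff_codressed_of_unit_rows)
open Summit.QuantumFields.BalabanUV.Beta.HessKerCoDressedBmWall (d1Drift_JsBalBmAn1At_iff_codressedBm_of_unit_rows)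
open Summit.QuantumFields.BalabanUV.Beta.GAN24.CombesThomas (ConvCKWall sfStep smStep sfStep_ne_zero smStep_ne_zero)
open AveragingMixedJetTables (vh₂SAt mixFFAt)

namespace Summit.QuantumFields.BalabanUV.Beta.HessKerConvCKPlug

noncomputable section

/-! ## §1 Rate and window merge -/

section Merge

variable {d : ℕ} {F : Type*}

/-- [folklore] A `BiLoc` bound weakens to a larger constant and a smaller rate (the tree's `biLoc_mono` keeps the constant). -/
theorem biLoc_mono' {K : MKer (d + 1) F} {p q : Fin (d + 1) → ℤ} {C C' δ δ' : ℝ} (h : BiLoc K p q C δ) (hC0 : 0 ≤ C) (hC : C ≤ C')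
    (hδ : δ' ≤ δ) : BiLoc K p q C' δ' :=
  fun x y a b => bound_mono (h x y a b) hC0 hC hδ (add_nonneg (l1_nonneg _) (l1_nonneg _))

/-- [folklore] A local stencil family weakens to a larger constant and a smaller rate. -/
theorem locStencil_mono' {S : Fin (d + 1) → (Fin (d + 1) → ℤ) → MKer (d + 1) (Fib d)} {C C' δ δ' : ℝ} (h : LocStencil S C δ)
    (hC0 : 0 ≤ C) (hC : C ≤ C') (hδ : δ' ≤ δ) : LocStencil S C' δ' :=
  fun κ u => biLoc_mono' (h κ u) hC0 hC hδ

/-- [folklore] A second-order vertex family weakens to a larger constant and a smaller rate. -/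
theorem vertexFamily₂_mono' {W : Fin (d + 1) → (Fin (d + 1) → ℤ) → Fin (d + 1) → (Fin (d + 1) → ℤ) → MKer (d + 1) (Fib d)} {N : ℕ}
    {C C' δ δ' : ℝ} (h : VertexFamily₂ W N C δ) (hC0 : 0 ≤ C) (hC : C ≤ C') (hδ : δ' ≤ δ) : VertexFamily₂ W N C' δ' :=
  fun μ y ν y' => biLoc_mono' (h μ y ν y') hC0 hC hδ

/-- [folklore] RATE MERGE for `Decays`-difference rows: a Cauchy row at rate `θ₁ ∈ [0, θ]` is a Cauchy row at rate `θ` (constant `≥ 0` by the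
`k = 0` row). -/
theorem decays_rows_rate_le {A : ℕ → MKer (d + 1) (Fib d)} {c θ₁ θ δ : ℝ} (h : ∀ k j, Decays (A (k + j) - A k) (c * θ₁ ^ k) δ)
    (h0 : 0 ≤ θ₁) (hle : θ₁ ≤ θ) : ∀ k j, Decays (A (k + j) - A k) (c * θ ^ k) δ := by
  have hc : 0 ≤ c := by simpa using (h 0 0).nonneg (Sum.inl 0)
  exact fun k j => decays_mono (h k j) (mul_nonneg hc (pow_nonneg h0 k)) (mul_le_mul_of_nonneg_left (pow_le_pow_left₀ h0 hle k) hc) le_rfl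

/-- [folklore] RATE MERGE for local-stencil difference rows. -/
theorem locStencil_rows_rate_le {S : ℕ → Fin (d + 1) → (Fin (d + 1) → ℤ) → MKer (d + 1) (Fib d)} {c θ₁ θ δ : ℝ}
    (h : ∀ k j, LocStencil (S (k + j) - S k) (c * θ₁ ^ k) δ) (h0 : 0 ≤ θ₁) (hle : θ₁ ≤ θ) :
    ∀ k j, LocStencil (S (k + j) - S k) (c * θ ^ k) δ := by
  have hc : 0 ≤ c := by simpa using ((h 0 0) 0 0).nonneg (Sum.inl 0)
  exact fun k j => locStencil_mono' (h k j) (mul_nonneg hc (pow_nonneg h0 k)) (mul_le_mul_of_nonneg_left (pow_le_pow_left₀ h0 hle k) hc)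
    le_rfl

/-- [folklore] RATE MERGE for second-order vertex-family difference rows. -/
theorem vertexFamily₂_rows_rate_le {W : ℕ → Fin (d + 1) → (Fin (d + 1) → ℤ) → Fin (d + 1) → (Fin (d + 1) → ℤ) → MKer (d + 1) (Fib d)}
    {N : ℕ} {c θ₁ θ δ : ℝ} (h : ∀ k j, VertexFamily₂ (W (k + j) - W k) N (c * θ₁ ^ k) δ) (h0 : 0 ≤ θ₁) (hle : θ₁ ≤ θ) :
    ∀ k j, VertexFamily₂ (W (k + j) - W k) N (c * θ ^ k) δ := by
  have hc : 0 ≤ c := by simpa using ((h 0 0) 0 0 0 0).nonneg (Sum.inl 0)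
  exact fun k j => vertexFamily₂_mono' (h k j) (mul_nonneg hc (pow_nonneg h0 k)) (mul_le_mul_of_nonneg_left (pow_le_pow_left₀ h0 hle k) hc)
    le_rfl

variable {Lc : ℕ} [NeZero Lc]

/-- [folklore] **THE MERGED ROW PACKAGE**: `ConvCKWall d Lc` (K-rows at its own `(C, δ_K, c_K, θ_K)`) + S-difference rows at rate `θ_S`, decay `δ_S > 0`
+ W-difference rows at rate `θ_W`, decay `δ_W > 0` ⟹ all three families of difference rows at ONE rate `θ = max (θ_K, θ_S, θ_W) ∈ [0, 1)` and a
window `0 < R < δ_K/4`, `R/2 < δ_S`, `R < δ_W` — the literal binder shape of the three sockets.  Nothing asserted: every row is a hypothesis. -/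
theorem exists_merged_rows (h : ConvCKWall d Lc) {S : ℕ → Fin (d + 1) → (Fin (d + 1) → ℤ) → MKer (d + 1) (Fib d)}
    {W : ℕ → Fin (d + 1) → (Fin (d + 1) → ℤ) → Fin (d + 1) → (Fin (d + 1) → ℤ) → MKer (d + 1) (Fib d)} {N : ℕ} {cS θS δS cW θW δW : ℝ}
    (hSall : ∀ k j, LocStencil (S (k + j) - S k) (cS * θS ^ k) δS) (hWall : ∀ k j, VertexFamily₂ (W (k + j) - W k) N (cW * θW ^ k) δW)
    (hδS : 0 < δS) (hδW : 0 < δW) (hθS0 : 0 ≤ θS) (hθS1 : θS < 1) (hθW0 : 0 ≤ θW) (hθW1 : θW < 1) :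
    ∃ C δK cK θ R : ℝ, 0 < R ∧ R < δK / 4 ∧ R / 2 < δS ∧ R < δW ∧ 0 ≤ θ ∧ θ < 1 ∧
      (∀ j, Decays (unitK (sfStep Lc j) (smStep d Lc j) (KInvStep (d := d) Lc j)) C δK) ∧
      (∀ k j, Decays (unitK (sfStep Lc (k + j)) (smStep d Lc (k + j)) (KInvStep (d := d) Lc (k + j)) -
        unitK (sfStep Lc k) (smStep d Lc k) (KInvStep (d := d) Lc k)) (cK * θ ^ k) δK) ∧
      (∀ k j, LocStencil (S (k + j) - S k) (cS * θ ^ k) δS) ∧ (∀ k j, VertexFamily₂ (W (k + j) - W k) N (cW * θ ^ k) δW) := by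
  obtain ⟨C, δK, cK, θK, hδK, hθK0, hθK1, hK, hKall⟩ := h
  have hK' : ∀ j, Decays (unitK (sfStep Lc j) (smStep d Lc j) (KInvStep (d := d) Lc j)) C δK := hK
  have hKall' : ∀ k j, Decays (unitK (sfStep Lc (k + j)) (smStep d Lc (k + j)) (KInvStep (d := d) Lc (k + j)) -
      unitK (sfStep Lc k) (smStep d Lc k) (KInvStep (d := d) Lc k)) (cK * θK ^ k) δK := hKall
  refine ⟨C, δK, cK, max θK (max θS θW), min (δK / 8) (min δS (δW / 2)), lt_min (by linarith) (lt_min hδS (by linarith)), ?_, ?_, ?_,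
    hθK0.trans (le_max_left _ _), max_lt hθK1 (max_lt hθS1 hθW1), hK',
    decays_rows_rate_le (A := fun j => unitK (sfStep Lc j) (smStep d Lc j) (KInvStep (d := d) Lc j)) hKall' hθK0 (le_max_left _ _),
    locStencil_rows_rate_le hSall hθS0 ((le_max_left _ _).trans (le_max_right _ _)),
    vertexFamily₂_rows_rate_le hWall hθW0 ((le_max_right _ _).trans (le_max_right _ _))⟩
  · exact (min_le_left _ _).trans_lt (by linarith)
  · have := (min_le_right (δK / 8) (min δS (δW / 2))).trans (min_le_left _ _); linarith
  · have := (min_le_right (δK / 8) (min δS (δW / 2))).trans (min_le_right _ _); linarith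

end Merge

/-! ## §2 The four sockets under `ConvCKWall 3 Lc` -/

section PlugJsBalOf

variable {Lc : ℕ} [NeZero Lc] (hLc : 1 ≤ Lc) (cE cVH cΛ : ℝ)
  (W : ℕ → Fin (3 + 1) → (Fin (3 + 1) → ℤ) → Fin (3 + 1) → (Fin (3 + 1) → ℤ) → MKer (3 + 1) (Fib 3))
  (Cw' δw : ℕ → ℝ) (hδw : ∀ j, 0 < δw j) (hW' : ∀ j, VertexFamily₂ (W j) Lc (Cw' j) (δw j)) {Cs cS δS θS Cw cW δW θW : ℝ}

/-- [folklore] **`ConvCKWall 3 Lc` ⟹ (the `JsBalOf` wall ⟺ the identification at the AXIALLY DRESSED constructed limits)** — the socket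
`HessKerDressedUnitsWall.d1Drift_JsBalOf_iff_of_cauchy_unit` in the adopted units, K-rows supplied by `ConvCKWall 3 Lc`, S-∕W-rows at their own
rates `θ_S`, `θ_W` and decays `δ_S`, `δ_W`, rate ∕ window merged by `exists_merged_rows`.  Discharges NOTHING (`ConvCKWall 3 Lc` and the S-∕W-rows are
hypotheses; the identification is O-asym1-7). -/
theorem d1Drift_JsBalOf_iff_of_convCKWall (h : ConvCKWall 3 Lc)
    (hS : ∀ j, LocStencil (unitS (sfStep Lc j) (smStep 3 Lc j) (JsBal0Of hLc cE cVH cΛ W Cw' δw hδw hW' j).S) Cs δS)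
    (hSall : ∀ k j, LocStencil (unitS (sfStep Lc (k + j)) (smStep 3 Lc (k + j)) (JsBal0Of hLc cE cVH cΛ W Cw' δw hδw hW' (k + j)).S -
      unitS (sfStep Lc k) (smStep 3 Lc k) (JsBal0Of hLc cE cVH cΛ W Cw' δw hδw hW' k).S) (cS * θS ^ k) δS)
    (hW : ∀ j, VertexFamily₂ (unitW (sfStep Lc j) (smStep 3 Lc j) (W j)) Lc Cw δW)
    (hWall : ∀ k j, VertexFamily₂ (unitW (sfStep Lc (k + j)) (smStep 3 Lc (k + j)) (W (k + j)) - unitW (sfStep Lc k) (smStep 3 Lc k) (W k)) Lc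
      (cW * θW ^ k) δW)
    (hδS : 0 < δS) (hδW : 0 < δW) (hθS0 : 0 ≤ θS) (hθS1 : θS < 1) (hθW0 : 0 ≤ θW) (hθW1 : θW < 1) (μ ν : Fin 4) (N : ℝ) :
    D1Drift Lc (JsBalOf hLc cE cVH cΛ W Cw' δw hδw hW') N μ ν ↔
      B12Beta.secondMoment (hessKer (axDressK Lc (limMKerOf fun j => unitK (sfStep Lc j) (smStep 3 Lc j) (KInvStep (d := 3) Lc j)))
        (axVertexOfK (limMKerOf fun j => unitK (sfStep Lc j) (smStep 3 Lc j) (KInvStep (d := 3) Lc j)) Lc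
          (limStOf fun j => unitS (sfStep Lc j) (smStep 3 Lc j) (JsBal0Of hLc cE cVH cΛ W Cw' δw hδw hW' j).S))
        (limTabOf fun j => unitW (sfStep Lc j) (smStep 3 Lc j) (W j))) μ ν = B12Normalization.stepBal N Lc := by
  obtain ⟨C, δK, cK, θ, R, hR, hRK, hRS, hRW, hθ0, hθ1, hK, hKall, hSall', hWall'⟩ :=
    exists_merged_rows (Lc := Lc) h (S := fun j => unitS (sfStep Lc j) (smStep 3 Lc j) (JsBal0Of hLc cE cVH cΛ W Cw' δw hδw hW' j).S)
      (W := fun j => unitW (sfStep Lc j) (smStep 3 Lc j) (W j)) hSall hWall hδS hδW hθS0 hθS1 hθW0 hθW1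
  exact d1Drift_JsBalOf_iff_of_cauchy_unit hLc cE cVH cΛ W Cw' δw hδw hW' (sfStep Lc) (smStep 3 Lc) sfStep_ne_zero smStep_ne_zero hK hKall hS
    hSall' hW hWall' hR (by linarith) hRS hRW hθ0 hθ1 μ ν N

end PlugJsBalOf

section Plug

variable {Lc : ℕ} [NeZero Lc] (hLc : 1 ≤ Lc) {r : Fin (3 + 1) → ℕ} (hr : r ∈ box (3 + 1) Lc) (cE cVH cΛ cE₂ cB : ℝ)
  (T : Fin 4 → Fin 4 → Fin 4 → Fin 4 → ℝ) (Sfl : ℕ → Fin (3 + 1) → (Fin (3 + 1) → ℤ) → MKer (3 + 1) (Fib 3))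
  (Wfl : ℕ → Fin (3 + 1) → (Fin (3 + 1) → ℤ) → Fin (3 + 1) → (Fin (3 + 1) → ℤ) → MKer (3 + 1) (Fib 3))
  {W₀ : ℕ → Fin (3 + 1) → (Fin (3 + 1) → ℤ) → Fin (3 + 1) → (Fin (3 + 1) → ℤ) → MKer (3 + 1) (Fib 3)} {Cw₀ δw₀ : ℕ → ℝ}
  {hδw₀ : ∀ j, 0 < δw₀ j} {hW₀ : ∀ j, VertexFamily₂ (W₀ j) Lc (Cw₀ j) (δw₀ j)} {Cs cS δS θS Cw cW δW θW : ℝ}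
  (hSfl : ∀ j, (JsBal0AtOf hLc hr cE cVH cΛ W₀ Cw₀ δw₀ hδw₀ hW₀ j).S = Sfl j)
  (hWfl : ∀ j, WbalAtOf 3 Lc (toSite r) cE cVH cΛ
    (T2AtOf 3 Lc (toSite r) cE cVH cΛ cE₂ cB T (vh₂SAt (toSite r) Lc) (mixFFAt (toSite r) Lc)) (mixFFAt (toSite r) Lc) j = Wfl j)
  (h : ConvCKWall 3 Lc)
  (hS : ∀ j, LocStencil (unitS (sfStep Lc j) (smStep 3 Lc j) (Sfl j)) Cs δS)
  (hSall : ∀ k j, LocStencil (unitS (sfStep Lc (k + j)) (smStep 3 Lc (k + j)) (Sfl (k + j)) - unitS (sfStep Lc k) (smStep 3 Lc k) (Sfl k))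
    (cS * θS ^ k) δS)
  (hW : ∀ j, VertexFamily₂ (unitW (sfStep Lc j) (smStep 3 Lc j) (Wfl j)) Lc Cw δW)
  (hWall : ∀ k j, VertexFamily₂ (unitW (sfStep Lc (k + j)) (smStep 3 Lc (k + j)) (Wfl (k + j)) - unitW (sfStep Lc k) (smStep 3 Lc k) (Wfl k))
    Lc (cW * θW ^ k) δW)
  (hδS : 0 < δS) (hδW : 0 < δW) (hθS0 : 0 ≤ θS) (hθS1 : θS < 1) (hθW0 : 0 ≤ θW) (hθW1 : θW < 1)
include hSfl hWfl h hS hSall hW hWall hδS hδW hθS0 hθS1 hθW0 hθW1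

/-- [folklore] **`ConvCKWall 3 Lc` ⟹ (v2.22's wall ⟺ the identification at the DRESSED ENTRYWISE constructed limits)** — the socket
`HessKerRootedWall.d1Drift_JsBalAn1At_iff_of_cauchy_unit` in the adopted units, K-rows supplied by `ConvCKWall 3 Lc`, S-∕W-rows at their own rates,
rate ∕ window merged by `exists_merged_rows`.  Discharges NOTHING (`ConvCKWall 3 Lc` and the S-∕W-rows are hypotheses; O-asym1-7 open). -/
theorem d1Drift_JsBalAn1At_iff_dressed_of_convCKWall (μ ν : Fin 4) (N : ℝ) :
    D1Drift Lc (JsBalAn1At hLc hr cE cVH cΛ cE₂ cB T) N μ ν ↔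
      B12Beta.secondMoment (hessKer (limMKerOf fun j => unitK (sfStep Lc j) (smStep 3 Lc j) (KInvStep (d := 3) Lc j))
        (vertexOfK (limMKerOf fun j => unitK (sfStep Lc j) (smStep 3 Lc j) (KInvStep (d := 3) Lc j)) Lc fun κ u => dressKAt (toSite r) Lc
          (coProjAtK (toSite r) Lc (limStOf fun j => unitS (sfStep Lc j) (smStep 3 Lc j) (Sfl j)) κ u))
        fun μ y ν y' => dressKAt (toSite r) Lc (limTabOf (fun j => unitW (sfStep Lc j) (smStep 3 Lc j) (Wfl j)) μ y ν y')) μ ν =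
        B12Normalization.stepBal N Lc := by
  obtain ⟨C, δK, cK, θ, R, hR, hRK, hRS, hRW, hθ0, hθ1, hK, hKall, hSall', hWall'⟩ :=
    exists_merged_rows (Lc := Lc) h (S := fun j => unitS (sfStep Lc j) (smStep 3 Lc j) (Sfl j))
      (W := fun j => unitW (sfStep Lc j) (smStep 3 Lc j) (Wfl j)) hSall hWall hδS hδW hθS0 hθS1 hθW0 hθW1
  exact d1Drift_JsBalAn1At_iff_of_cauchy_unit hLc hr cE cVH cΛ cE₂ cB T Sfl Wfl (sfStep Lc) (smStep 3 Lc) hSfl hWfl sfStep_ne_zero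
    smStep_ne_zero hK hKall hS hSall' hW hWall' hR (by linarith) hRS hRW hθ0 hθ1 μ ν N

/-- [folklore] **`ConvCKWall 3 Lc` ⟹ (v2.22's wall ⟺ the identification at the ROOTED CO-DRESSED constructed limit)** — the socket
`HessKerCoDressedWall.d1Drift_JsBalAn1At_iff_codressed_of_unit_rows` (window `R < δK/4`) in the adopted units, K-rows supplied by `ConvCKWall 3 Lc`,
rates ∕ window merged.  Discharges NOTHING. -/
theorem d1Drift_JsBalAn1At_iff_codressed_of_convCKWall (μ ν : Fin 4) (N : ℝ) :
    D1Drift Lc (JsBalAn1At hLc hr cE cVH cΛ cE₂ cB T) N μ ν ↔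
      B12Beta.secondMoment (hessKer (limMKerOf fun j => unitK (sfStep Lc j) (smStep 3 Lc j) (coDressKAt (toSite r) Lc (KInvStep (d := 3) Lc j)))
        (vertexOfK (limMKerOf fun j => unitK (sfStep Lc j) (smStep 3 Lc j) (coDressKAt (toSite r) Lc (KInvStep (d := 3) Lc j))) Lc
          (limStOf fun j => unitS (sfStep Lc j) (smStep 3 Lc j) (Sfl j)))
        (limTabOf fun j => unitW (sfStep Lc j) (smStep 3 Lc j) (Wfl j))) μ ν = B12Normalization.stepBal N Lc := by
  obtain ⟨C, δK, cK, θ, R, hR, hRK, hRS, hRW, hθ0, hθ1, hK, hKall, hSall', hWall'⟩ :=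
    exists_merged_rows (Lc := Lc) h (S := fun j => unitS (sfStep Lc j) (smStep 3 Lc j) (Sfl j))
      (W := fun j => unitW (sfStep Lc j) (smStep 3 Lc j) (Wfl j)) hSall hWall hδS hδW hθS0 hθS1 hθW0 hθW1
  exact d1Drift_JsBalAn1At_iff_codressed_of_unit_rows hLc hr cE cVH cΛ cE₂ cB T Sfl Wfl (sfStep Lc) (smStep 3 Lc) hSfl hWfl sfStep_ne_zero
    smStep_ne_zero hK hKall hS hSall' hW hWall' hR hRK hRS hRW hθ0 hθ1 μ ν N

/-- [folklore] **`ConvCKWall 3 Lc` ⟹ (v2.23's wall ⟺ the identification at the BLOCK-MEAN CO-DRESSED constructed limit)** — the socket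
`HessKerCoDressedBmWall.d1Drift_JsBalBmAn1At_iff_codressedBm_of_unit_rows` (window `R < δK/4`) in the adopted units, K-rows supplied by
`ConvCKWall 3 Lc`, rates ∕ window merged.  Discharges NOTHING (v2.23 is a CANDIDATE pending (R42-1)). -/
theorem d1Drift_JsBalBmAn1At_iff_codressedBm_of_convCKWall (μ ν : Fin 4) (N : ℝ) :
    D1Drift Lc (JsBalBmAn1At hLc hr cE cVH cΛ cE₂ cB T) N μ ν ↔
      B12Beta.secondMoment (hessKer (limMKerOf fun j => unitK (sfStep Lc j) (smStep 3 Lc j) (coDressKBmAt (toSite r) Lc (KInvStep (d := 3) Lc j)))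
        (vertexOfK (limMKerOf fun j => unitK (sfStep Lc j) (smStep 3 Lc j) (coDressKBmAt (toSite r) Lc (KInvStep (d := 3) Lc j))) Lc
          (limStOf fun j => unitS (sfStep Lc j) (smStep 3 Lc j) (Sfl j)))
        (limTabOf fun j => unitW (sfStep Lc j) (smStep 3 Lc j) (Wfl j))) μ ν = B12Normalization.stepBal N Lc := by
  obtain ⟨C, δK, cK, θ, R, hR, hRK, hRS, hRW, hθ0, hθ1, hK, hKall, hSall', hWall'⟩ :=
    exists_merged_rows (Lc := Lc) h (S := fun j => unitS (sfStep Lc j) (smStep 3 Lc j) (Sfl j))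
      (W := fun j => unitW (sfStep Lc j) (smStep 3 Lc j) (Wfl j)) hSall hWall hδS hδW hθS0 hθS1 hθW0 hθW1
  exact d1Drift_JsBalBmAn1At_iff_codressedBm_of_unit_rows hLc hr cE cVH cΛ cE₂ cB T Sfl Wfl (sfStep Lc) (smStep 3 Lc) hSfl hWfl sfStep_ne_zero
    smStep_ne_zero hK hKall hS hSall' hW hWall' hR hRK hRS hRW hθ0 hθ1 μ ν N

end Plug

end

end Summit.QuantumFields.BalabanUV.Beta.HessKerConvCKPlug
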